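import Mathlib
import Literature.Combinatorics.Additive.RestrictedSumsetsInRootsOfUnityBoundZero
import Summits.ValiantsHypothesis.ValiantsHypothesis.Theorems.FeketeSOSCharPSparseSOSSumCliquePolynomialMethod

/-!
# Crux `FeketeSOS.CharPSparseSOS` (stmt-ValiantsHypothesis-14989) — the anti-diagonal class is ONE NOTCH below
counting when `2` is a non-residue (lead c8)

The residual configuration of (CORE) recorded by leads c3–c7 (`Cruxes/CharPSparseSOS/NOTES.md` §Q.2, §S.2(d)) is an
ANTI-DIAGONAL restricted Paley sum-clique: `T ⊂ 𝔽_p` with `(a + b|p) = 1` for all `a ≠ b` in `T` and `(2a|p) = −1` for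
every `a ∈ T`; there the four classical tools (counting, completion, Stepanov–Hanson–Petridis, parity) are all
"tautological at the counting scale" `|T|(|T|−1) ≤ p − 1`.

This file records the first statement BELOW that scale on the anti-diagonal class, kernel-checked and Sidon-free:

  **if `(2|p) = −1` (i.e. `p ≡ ±3 (mod 8)`), every anti-diagonal restricted sum-clique has `|T|(|T|+1) ≤ p − 1`**
  (`allBad_sumClique_card_mul_succ_le`), i.e. `|T| ≤ √p − 1/2`: one notch below counting (`√p + 1/2`), and the
  deficiency `m = (p−1)/2 − |T|(|T|−1)/2` is at least `|T|` (`allBad_sumClique_card_le_deficiency`) — the statement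
  `CoreSumCliqueOneNotch` of the strategist's census, on the all-bad class, for half of the primes.

Mechanism (Yip 2025, Prop. 3.1 with its `0 ∈ A` clause; `Literature.Combinatorics.Additive.Yip`, landed with this
file): `(2a|p) = −1 = (2|p)` forces `(a|p) = +1`, so `T ⊂ QR` and `0` is adjacent to every point of `T` in the Paley
sum graph; `T ∪ {0}` is a restricted sum-clique of size `|T| + 1` whose only non-bad diagonal is `2·0 = 0`, and Yip's
Stepanov bound for `T ∪ {0}` (odd size: `+1` for the point `0`; even size: the `0 ∈ A` refinement, no loss) reads
`|T|(|T|+1)/2 ≤ (p−1)/2`.  Tight at `p = 13`: `T = {1, 3, 9}` (`T ∪ {0}` is the perfect clique `{0,1,3,9}`).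
For `(2|p) = +1` the anti-diagonal class lies in the NON-residues, `0` is not adjacent, and nothing below counting is
known.  (CORE) needs `m ≥ p^{1/2+δ}/2`, i.e. `p^δ` notches; this is one.
-/

-- `Summit.ValiantsHypothesis.ValiantsHypothesis.…` is the tree's mandated single-conjunct layout (Sub = Summit).
set_option linter.dupNamespace false

namespace Summit.ValiantsHypothesis.ValiantsHypothesis.Theorems.CharPSparseSOSTwoCusp

open Finset
open Literature.Combinatorics.Additive.Yip

/-- In the anti-diagonal class with `(2|p) = −1` every point is a non-zero quadratic residue: `(2a|p) = −1 = (2|p)`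
forces `(a|p) = 1`. -/
theorem oneNotch_legendreSym_val_eq_one {p : ℕ} [Fact p.Prime] (h2 : legendreSym p 2 = -1) (a : ZMod p)
    (ha : legendreSym p (a + a).val = -1) : legendreSym p a.val = 1 := by
  have hq2 : legendreSym p 2 = quadraticChar (ZMod p) 2 := by rw [legendreSym, Int.cast_ofNat]
  rw [legendreSym_val_eq_quadraticChar, ← two_mul, map_mul, ← hq2, h2] at ha
  rw [legendreSym_val_eq_quadraticChar]
  have ha0 : a ≠ 0 := by
    intro h
    rw [h, quadraticChar_zero, mul_zero] at ha
    norm_num at ha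
  rcases quadraticChar_dichotomy ha0 with h | h
  · exact h
  · rw [h] at ha
    norm_num at ha

/-- **One notch below counting on the anti-diagonal class, `(2|p) = −1`** (registered sub-goal).  Let `p` be a prime
with `(2|p) = −1` and `T ⊆ 𝔽_p` a restricted Paley sum-clique — `(a + b|p) = 1` for all `a ≠ b` in `T` — all of whose
diagonals are bad, `(2a|p) = −1` for every `a ∈ T`.  Then `|T| (|T| + 1) ≤ p − 1`.  No Sidon hypothesis.  Proof:
`T ⊂ QR`, so `T ∪ {0}` is a restricted clique of size `|T| + 1` with `0` its only non-bad diagonal; apply Yip's bound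
(odd size, [cite: Yip2025, Prop. 3.1]) or its `0 ∈ A` refinement (even size). -/
theorem allBad_sumClique_card_mul_succ_le :
    ∀ {p : ℕ} [Fact p.Prime], legendreSym p 2 = -1 → ∀ (Q : Finset (ZMod p)),
      (∀ a ∈ Q, ∀ b ∈ Q, a ≠ b → legendreSym p (a + b).val = 1) →
      (∀ a ∈ Q, legendreSym p (a + a).val = -1) → Q.card * (Q.card + 1) ≤ p - 1 := by
  intro p hp h2 Q hclique hbad
  classical
  -- `2 ≠ 0` in `𝔽_p`, `p` odd
  have htwo : (2 : ZMod p) ≠ 0 := by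
    intro h
    have : legendreSym p 2 = 0 := (legendreSym.eq_zero_iff p 2).mpr (by exact_mod_cast h)
    rw [this] at h2
    norm_num at h2
  have hp2 : p ≠ 2 := by
    rintro rfl
    have h22 : ((2 : ℕ) : ZMod 2) = 0 := ZMod.natCast_self 2
    exact htwo (by exact_mod_cast h22)
  have hpodd : p % 2 = 1 := Nat.odd_iff.mp (hp.out.odd_of_ne_two hp2)
  -- trivial when `Q = ∅`
  rcases Q.eq_empty_or_nonempty with rfl | ⟨a₀, ha₀⟩
  · simp
  -- `0 ∉ Q` and every point of `Q` is a non-zero residue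
  have h0Q : (0 : ZMod p) ∉ Q := by
    intro h0
    have := hbad 0 h0
    rw [add_zero, ZMod.val_zero, Nat.cast_zero, legendreSym.at_zero] at this
    norm_num at this
  have hQR : ∀ a ∈ Q, legendreSym p a.val = 1 := fun a ha => oneNotch_legendreSym_val_eq_one h2 a (hbad a ha)
  -- the extended clique `A = Q ∪ {0}`
  set A := insert (0 : ZMod p) Q with hA
  have hcardA : A.card = Q.card + 1 := by rw [hA, card_insert_of_notMem h0Q]
  have hcliqueA : ∀ a ∈ A, ∀ b ∈ A, a ≠ b → (a + b) ^ (p / 2) = 1 := by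
    intro a ha b hb hab
    rw [hA, mem_insert] at ha hb
    rcases ha with rfl | ha
    · rcases hb with rfl | hb
      · exact absurd rfl hab
      · rw [zero_add]; exact pow_div_two_eq_one_of_legendreSym_val _ (hQR b hb)
    · rcases hb with rfl | hb
      · rw [add_zero]; exact pow_div_two_eq_one_of_legendreSym_val _ (hQR a ha)
      · exact pow_div_two_eq_one_of_legendreSym_val _ (hclique a ha b hb hab)
  have hbadA : ∃ b₀ ∈ A, 2 * b₀ ≠ 0 ∧ (2 * b₀) ^ (p / 2) ≠ 1 := by
    have ha₀0 : a₀ ≠ 0 := fun h => h0Q (h ▸ ha₀)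
    refine ⟨a₀, by rw [hA]; exact mem_insert_of_mem ha₀, mul_ne_zero htwo ha₀0, fun h => ?_⟩
    have h1 : legendreSym p (a₀ + a₀).val = 1 := by
      rw [← two_mul]
      have hsq : IsSquare (2 * a₀) := (ZMod.euler_criterion p (mul_ne_zero htwo ha₀0)).mpr h
      have hx' : (((2 * a₀).val : ℤ) : ZMod p) ≠ 0 := by
        rw [Int.cast_natCast, ZMod.natCast_zmod_val]; exact mul_ne_zero htwo ha₀0
      rw [legendreSym.eq_one_iff p hx', Int.cast_natCast, ZMod.natCast_zmod_val]
      exact hsq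
    have := hbad a₀ ha₀
    rw [h1] at this
    norm_num at this
  -- `q (q+1)` is even and `2 (p/2) = p − 1`
  have hev : 2 ∣ Q.card * (Q.card + 1) := (Nat.even_mul_succ_self Q.card).two_dvd
  have hdiv := Nat.div_mul_cancel hev
  have hchooseA : A.card * (A.card - 1) / 2 = Q.card * (Q.card + 1) / 2 := by
    rw [hcardA, Nat.add_sub_cancel, mul_comm]
  rcases Nat.even_or_odd A.card with heven | hodd
  · -- even size: the `0 ∈ A` refinement, no loss
    have h := choose_two_add_card_good_le_of_restrictedSumset_subset_rootsOfUnity_of_zero_mem (p / 2) A hcliqueA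
      (by rw [hA]; exact mem_insert_self _ _) heven hbadA
    rw [hchooseA] at h
    set N := Q.card * (Q.card + 1)
    omega
  · -- odd size: the point `0` has a non-bad diagonal (`2·0 = 0`), worth one unit
    have h := choose_two_add_card_good_le_of_restrictedSumset_subset_rootsOfUnity (p / 2) A hcliqueA hodd hbadA
    rw [hchooseA] at h
    have hone : 1 ≤ (A.filter fun a => 2 * a = 0 ∨ (2 * a) ^ (p / 2) = 1).card := by
      refine Finset.card_pos.mpr ⟨0, ?_⟩
      rw [mem_filter]
      exact ⟨by rw [hA]; exact mem_insert_self _ _, Or.inl (mul_zero 2)⟩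
    set N := Q.card * (Q.card + 1)
    omega

/-- **The deficiency of an anti-diagonal restricted sum-clique is at least its size, `(2|p) = −1`.**  With
`m := (p−1)/2 − |T|(|T|−1)/2` (the number of non-zero quadratic residues that are NOT restricted sums of `T` when `T`
is weak-Sidon), `allBad_sumClique_card_mul_succ_le` says `|T| ≤ m`, written here without subtraction:
`|T|(|T|−1)/2 + |T| ≤ (p−1)/2`.  This is `CoreSumCliqueOneNotch` (census `STRATEGY-CENSUS.md` §0) on the all-bad class
for the primes `p ≡ ±3 (mod 8)`; (CORE) asks for `m ≥ p^{1/2+δ}/2 − O(√p)` there. -/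
theorem allBad_sumClique_card_le_deficiency {p : ℕ} [Fact p.Prime] (h2 : legendreSym p 2 = -1)
    (Q : Finset (ZMod p)) (hclique : ∀ a ∈ Q, ∀ b ∈ Q, a ≠ b → legendreSym p (a + b).val = 1)
    (hbad : ∀ a ∈ Q, legendreSym p (a + a).val = -1) :
    Q.card * (Q.card - 1) / 2 + Q.card ≤ p / 2 := by
  have h := allBad_sumClique_card_mul_succ_le h2 Q hclique hbad
  have hev : 2 ∣ Q.card * (Q.card - 1) := (Nat.even_mul_pred_self Q.card).two_dvd
  have hdiv := Nat.div_mul_cancel hev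
  have hid : Q.card * (Q.card + 1) = Q.card * (Q.card - 1) + 2 * Q.card := by
    rcases Q.card with _ | q
    · simp
    · rw [Nat.add_sub_cancel]; ring
  set N := Q.card * (Q.card - 1)
  set N' := Q.card * (Q.card + 1)
  omega

end Summit.ValiantsHypothesis.ValiantsHypothesis.Theorems.CharPSparseSOSTwoCusp
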